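import Summits.AtomisticToContinuum.Crystallization.Theorems.ExcessDecayLiouvilleLinearisation
import Summits.AtomisticToContinuum.Crystallization.Theorems.ExcessDecayLiouvilleHcpLiouvilleDefs

/-!
# `ExcessDecayLiouville.HcpLiouville` (stmt-AtomisticToContinuum-9332), line `Sketch`, level 1: the secant force-constant form

Pair-level calculus for the nonlinear (secant) Caccioppoli inequality `stub_levelOneGrowth` of the line
`two-level-caccioppoli` (crux `HcpLiouville`).  With `h(x) = −x⁻⁷ + x⁻⁴` the Lennard-Jones pair force is
`F(e) = (V′(|e|)/|e|)·e = h(|e|²)·e` (`ljForce_eq_smul`), its differential at a bond `e` is the symmetric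
force-constant map `K(e)w = h(|e|²)w + 2h′(|e|²)⟪e,w⟫e`, and we name

* `LevelOne.kForm e w w' = ⟪K(e)w, w'⟫` — the BILINEAR force-constant form (`kForm e w w = Hess₀ e w`);
* `LevelOne.secK e d w w' = ∫₀¹ kForm (e + θd) w w' dθ` — its θ-average along the segment from the bond `e`
  to the displaced bond `e + d` (`secK e d w w = secHess e d w`, the vocabulary's secant pair form).

Facts: symmetry, evenness `secK (−e) (−d) = secK e d`, additivity / homogeneity in `w`, the bound
`|secK e d w w'| ≤ 248064·|e|⁻⁸‖w‖‖w'‖` for `|e| ≥ 23/25`, `|d| ≤ 3/20`, and the SECANT IDENTITY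
`⟪F(e + d) − F(e), w'⟫ = secK e d d w'` (fundamental theorem of calculus along the segment): the point of
the secant form is that the difference of two force-balance equations is EXACTLY linear in the
displacement differences, with no Taylor remainder.  All `[folklore]`; a `--supports` helper file for item
stmt-AtomisticToContinuum-9332, nothing here closes an item.
-/

noncomputable section

namespace Summit.AtomisticToContinuum.Crystallization.Theorems.ExcessDecayLiouville

open scoped BigOperators Topology Classical InnerProductSpace RealInnerProductSpace
open Literature.MathematicalPhysics.StatisticalMechanics
open Summit.AtomisticToContinuum.Crystallization.Theses.ExcessDecayLiouville
open Summit.AtomisticToContinuum.Crystallization.Theorems.PhononStabilityNegative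

local notation "E3" => EuclideanSpace ℝ (Fin 3)

namespace LevelOne

/-! ## The scalar profile and the bilinear force-constant form -/

/-- The profile `h(x) = −x⁻⁷ + x⁻⁴` with `F(e) = h(|e|²)e`. [folklore] -/
def ljH (x : ℝ) : ℝ := -(x⁻¹) ^ 7 + (x⁻¹) ^ 4

/-- Its derivative `h′(x) = 7x⁻⁸ − 4x⁻⁵`. [folklore] -/
def ljH' (x : ℝ) : ℝ := 7 * (x⁻¹) ^ 8 - 4 * (x⁻¹) ^ 5

/-- **Bilinear force-constant form** `⟪K(e)w, w'⟫ = h(|e|²)⟪w,w'⟫ + 2h′(|e|²)⟪e,w⟫⟪e,w'⟫`. [folklore] -/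
def kForm (e w w' : E3) : ℝ :=
  ljH (‖e‖ ^ 2) * ⟪w, w'⟫ + 2 * ljH' (‖e‖ ^ 2) * ⟪e, w⟫ * ⟪e, w'⟫

/-- **Secant (θ-averaged) bilinear form** along the segment from `e` to `e + d`. [folklore] -/
def secK (e d w w' : E3) : ℝ :=
  ∫ θ in (0 : ℝ)..1, kForm (e + θ • d) w w'

/-- `h` has derivative `h′` away from `0`. [folklore] -/
theorem hasDerivAt_ljH {x : ℝ} (hx : x ≠ 0) : HasDerivAt ljH (ljH' x) x :=
  hasDerivAt_ljProfile hx

/-- `h′` is differentiable (hence continuous) away from `0`. [folklore] -/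
theorem hasDerivAt_ljH' {x : ℝ} (hx : x ≠ 0) :
    HasDerivAt ljH' (-56 * (x⁻¹) ^ 9 + 20 * (x⁻¹) ^ 6) x :=
  hasDerivAt_ljProfile' hx

/-- `h(0) = 0` (junk value `0⁻¹ = 0`), so `F(e) = h(|e|²)e` holds at `e = 0` too. [folklore] -/
@[simp] theorem ljH_zero : ljH 0 = 0 := by simp [ljH]

/-- **The pair force is `h(|e|²)e`** for every `e` (including `e = 0`). [folklore] -/
theorem ljForce_eq (e : E3) : (deriv lennardJones ‖e‖ / ‖e‖) • e = ljH (‖e‖ ^ 2) • e := by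
  rcases eq_or_ne e 0 with rfl | he
  · simp
  · exact ljForce_eq_smul he

/-- The force-constant map tested against `w'` is `kForm`. [folklore] -/
theorem inner_forceConst (e w w' : E3) :
    ⟪ljH (‖e‖ ^ 2) • w + (2 * ⟪e, w⟫ * ljH' (‖e‖ ^ 2)) • e, w'⟫ = kForm e w w' := by
  rw [kForm, inner_add_left, real_inner_smul_left, real_inner_smul_left]
  ring

/-- **On the diagonal `kForm` is the route's `Hess`**: `kForm e w w = Hess₀ e w` (`e ≠ 0`). [folklore] -/
theorem kForm_self {e : E3} (he : e ≠ 0) (w : E3) : kForm e w w = Hess₀ e w := by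
  rw [← inner_forceConst]
  exact inner_forceConst_eq_Hess₀ he w

/-- `kForm` is symmetric. [folklore] -/
theorem kForm_comm (e w w' : E3) : kForm e w w' = kForm e w' w := by
  rw [kForm, kForm, real_inner_comm w w']
  ring

/-- `kForm` is even in the bond. [folklore] -/
theorem kForm_neg (e w w' : E3) : kForm (-e) w w' = kForm e w w' := by
  simp only [kForm, norm_neg, inner_neg_left]
  ring

/-- `kForm` is additive in `w`. [folklore] -/
theorem kForm_add_left (e w₁ w₂ w' : E3) :
    kForm e (w₁ + w₂) w' = kForm e w₁ w' + kForm e w₂ w' := by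
  simp only [kForm, inner_add_left, inner_add_right]
  ring

/-- `kForm` is homogeneous in `w`. [folklore] -/
theorem kForm_smul_left (e w w' : E3) (c : ℝ) : kForm e (c • w) w' = c * kForm e w w' := by
  simp only [kForm, real_inner_smul_left, real_inner_smul_right]
  ring

/-- `kForm e 0 w' = 0`. [folklore] -/
@[simp] theorem kForm_zero_left (e w' : E3) : kForm e 0 w' = 0 := by
  simp [kForm]

/-- `kForm` vanishes at the zero bond (junk value `h(0) = 0`). [folklore] -/
@[simp] theorem kForm_zero_bond (w w' : E3) : kForm 0 w w' = 0 := by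
  simp [kForm]

/-- **Crude bound** `|kForm e w w'| ≤ 969·|e|⁻⁸‖w‖‖w'‖` for `|e| ≥ 1/2`
(`|h| ≤ x⁻⁷ + x⁻⁴`, `2|h′|x ≤ 14x⁻⁷ + 8x⁻⁴`, `|e|⁻⁶ ≤ 64`). [folklore] -/
theorem abs_kForm_le {e : E3} (he : (1 / 2 : ℝ) ≤ ‖e‖) (w w' : E3) :
    |kForm e w w'| ≤ 969 * (‖e‖⁻¹) ^ 8 * ‖w‖ * ‖w'‖ := by
  have hpos : 0 < ‖e‖ := by linarith
  set u := ‖e‖⁻¹ with hu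
  have hu0 : 0 < u := inv_pos.2 hpos
  have hue : u * ‖e‖ = 1 := by rw [hu, inv_mul_cancel₀ hpos.ne']
  have hu2 : u ≤ 2 := by rw [hu]; exact inv_le_of_inv_le₀ (by norm_num) (by simpa using he)
  have hx : (‖e‖ ^ 2)⁻¹ = u ^ 2 := by rw [hu, inv_pow]
  have hW : 0 ≤ ‖w‖ * ‖w'‖ := by positivity
  have h1 : |ljH (‖e‖ ^ 2) * ⟪w, w'⟫| ≤ (u ^ 14 + u ^ 8) * (‖w‖ * ‖w'‖) := by
    rw [abs_mul]
    refine mul_le_mul ?_ (abs_real_inner_le_norm w w') (abs_nonneg _) (by positivity)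
    rw [ljH, hx]
    refine abs_le.2 ⟨?_, ?_⟩ <;> nlinarith [pow_nonneg hu0.le 14, pow_nonneg hu0.le 8]
  have h2 : |2 * ljH' (‖e‖ ^ 2) * ⟪e, w⟫ * ⟪e, w'⟫| ≤ (14 * u ^ 14 + 8 * u ^ 8) * (‖w‖ * ‖w'‖) := by
    have hi1 : |⟪e, w⟫| ≤ ‖e‖ * ‖w‖ := abs_real_inner_le_norm e w
    have hi2 : |⟪e, w'⟫| ≤ ‖e‖ * ‖w'‖ := abs_real_inner_le_norm e w'
    have hh : |ljH' (‖e‖ ^ 2)| ≤ 7 * u ^ 16 + 4 * u ^ 10 := by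
      rw [ljH', hx]
      refine abs_le.2 ⟨?_, ?_⟩ <;> nlinarith [pow_nonneg hu0.le 16, pow_nonneg hu0.le 10]
    calc |2 * ljH' (‖e‖ ^ 2) * ⟪e, w⟫ * ⟪e, w'⟫|
        = 2 * |ljH' (‖e‖ ^ 2)| * |⟪e, w⟫| * |⟪e, w'⟫| := by
          rw [abs_mul, abs_mul, abs_mul, abs_two]
      _ ≤ 2 * (7 * u ^ 16 + 4 * u ^ 10) * (‖e‖ * ‖w‖) * (‖e‖ * ‖w'‖) := by
          gcongr
      _ = (14 * u ^ 14 + 8 * u ^ 8) * (u * ‖e‖) ^ 2 * (‖w‖ * ‖w'‖) := by ring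
      _ = (14 * u ^ 14 + 8 * u ^ 8) * (‖w‖ * ‖w'‖) := by rw [hue]; ring
  have hu6 : u ^ 6 ≤ 64 := by
    calc u ^ 6 ≤ 2 ^ 6 := pow_le_pow_left₀ hu0.le hu2 6
      _ = 64 := by norm_num
  have h14 : u ^ 14 ≤ 64 * u ^ 8 := by
    have : u ^ 14 = u ^ 6 * u ^ 8 := by ring
    rw [this]
    exact mul_le_mul_of_nonneg_right hu6 (pow_nonneg hu0.le 8)
  calc |kForm e w w'| ≤ |ljH (‖e‖ ^ 2) * ⟪w, w'⟫| + |2 * ljH' (‖e‖ ^ 2) * ⟪e, w⟫ * ⟪e, w'⟫| :=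
        abs_add_le _ _
    _ ≤ (u ^ 14 + u ^ 8) * (‖w‖ * ‖w'‖) + (14 * u ^ 14 + 8 * u ^ 8) * (‖w‖ * ‖w'‖) := add_le_add h1 h2
    _ = (15 * u ^ 14 + 9 * u ^ 8) * (‖w‖ * ‖w'‖) := by ring
    _ ≤ (15 * (64 * u ^ 8) + 9 * u ^ 8) * (‖w‖ * ‖w'‖) := by gcongr
    _ = 969 * u ^ 8 * ‖w‖ * ‖w'‖ := by ring

/-- `kForm · w w'` is continuous at every nonzero bond. [folklore] -/
theorem continuousAt_kForm {y : E3} (hy : y ≠ 0) (w w' : E3) :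
    ContinuousAt (fun z : E3 => kForm z w w') y := by
  have hx : ‖y‖ ^ 2 ≠ 0 := by positivity
  have hn : Continuous fun z : E3 => ‖z‖ ^ 2 := (continuous_norm.pow 2)
  have h1 : ContinuousAt (fun z : E3 => ljH (‖z‖ ^ 2)) y :=
    ContinuousAt.comp (f := fun z : E3 => ‖z‖ ^ 2) (x := y) (hasDerivAt_ljH hx).continuousAt
      hn.continuousAt
  have h2 : ContinuousAt (fun z : E3 => ljH' (‖z‖ ^ 2)) y :=
    ContinuousAt.comp (f := fun z : E3 => ‖z‖ ^ 2) (x := y) (hasDerivAt_ljH' hx).continuousAt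
      hn.continuousAt
  have h3 : Continuous fun z : E3 => ⟪z, w⟫ := continuous_id.inner continuous_const
  have h4 : Continuous fun z : E3 => ⟪z, w'⟫ := continuous_id.inner continuous_const
  unfold kForm
  exact (h1.mul continuousAt_const).add
    (((continuousAt_const.mul h2).mul h3.continuousAt).mul h4.continuousAt)

/-! ## Along the segment `θ ↦ e + θ d` -/

/-- On the segment, `‖e + θd‖ ≥ ‖e‖ − ‖d‖`. [folklore] -/
theorem norm_sub_le_norm_add_smul (e d : E3) {θ : ℝ} (h0 : 0 ≤ θ) (h1 : θ ≤ 1) :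
    ‖e‖ - ‖d‖ ≤ ‖e + θ • d‖ := by
  have h := norm_sub_norm_le e (-(θ • d))
  rw [sub_neg_eq_add, norm_neg, norm_smul, Real.norm_eq_abs, abs_of_nonneg h0] at h
  nlinarith [norm_nonneg d]

/-- On the segment the bond does not vanish when `‖d‖ < ‖e‖`. [folklore] -/
theorem add_smul_ne_zero {e d : E3} (hd : ‖d‖ < ‖e‖) {θ : ℝ} (h0 : 0 ≤ θ) (h1 : θ ≤ 1) :
    e + θ • d ≠ 0 := by
  intro h
  have := norm_sub_le_norm_add_smul e d h0 h1
  rw [h, norm_zero] at this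
  linarith

/-- The integrand of `secK` is continuous on `[0,1]` when `‖d‖ < ‖e‖`. [folklore] -/
theorem continuousOn_kForm_segment {e d : E3} (hd : ‖d‖ < ‖e‖) (w w' : E3) :
    ContinuousOn (fun θ : ℝ => kForm (e + θ • d) w w') (Set.uIcc 0 1) := by
  rw [Set.uIcc_of_le zero_le_one]
  intro θ hθ
  have hpath : Continuous fun θ : ℝ => e + θ • d := continuous_const.add (continuous_id.smul continuous_const)
  exact (ContinuousAt.comp (f := fun θ : ℝ => e + θ • d) (x := θ)
    (continuousAt_kForm (add_smul_ne_zero hd hθ.1 hθ.2) w w') hpath.continuousAt).continuousWithinAt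

/-- The integrand of `secK` is interval integrable on `[0,1]` when `‖d‖ < ‖e‖`. [folklore] -/
theorem intervalIntegrable_kForm_segment {e d : E3} (hd : ‖d‖ < ‖e‖) (w w' : E3) :
    IntervalIntegrable (fun θ : ℝ => kForm (e + θ • d) w w') MeasureTheory.volume 0 1 :=
  (continuousOn_kForm_segment hd w w').intervalIntegrable

/-- **Derivative of the force along the segment**, tested against `w'`:
`d/dθ ⟪F(e + θd), w'⟫ = kForm (e + θd) d w'` wherever `e + θd ≠ 0`. [folklore] -/
theorem hasDerivAt_inner_force_segment (e d w' : E3) {θ : ℝ} (hθ : e + θ • d ≠ 0) :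
    HasDerivAt (fun θ : ℝ => ⟪ljH (‖e + θ • d‖ ^ 2) • (e + θ • d), w'⟫)
      (kForm (e + θ • d) d w') θ := by
  have hpath : HasDerivAt (fun θ : ℝ => e + θ • d) d θ := by
    have h := ((hasDerivAt_id θ).smul_const d).const_add e
    simpa using h
  have hx : ‖e + θ • d‖ ^ 2 ≠ 0 := by positivity
  have hsq : HasDerivAt (fun θ : ℝ => ‖e + θ • d‖ ^ 2) (2 * ⟪e + θ • d, d⟫) θ := hpath.norm_sq
  have hh₀ := (hasDerivAt_ljH hx).comp θ hsq
  have hh : HasDerivAt (fun θ : ℝ => ljH (‖e + θ • d‖ ^ 2))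
      (ljH' (‖e + θ • d‖ ^ 2) * (2 * ⟪e + θ • d, d⟫)) θ := hh₀
  have hF : HasDerivAt (fun θ : ℝ => ljH (‖e + θ • d‖ ^ 2) • (e + θ • d))
      (ljH (‖e + θ • d‖ ^ 2) • d + (ljH' (‖e + θ • d‖ ^ 2) * (2 * ⟪e + θ • d, d⟫)) • (e + θ • d)) θ :=
    hh.smul hpath
  have hI := hF.inner ℝ (hasDerivAt_const θ w')
  simp only [inner_zero_right, zero_add] at hI
  refine hI.congr_deriv ?_
  rw [← inner_forceConst]
  rw [show ljH' (‖e + θ • d‖ ^ 2) * (2 * ⟪e + θ • d, d⟫) = 2 * ⟪e + θ • d, d⟫ * ljH' (‖e + θ • d‖ ^ 2)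
    by ring]

/-- **The secant identity**: `⟪F(e + d) − F(e), w'⟫ = secK e d d w'` for `‖d‖ < ‖e‖` (fundamental theorem
of calculus along the segment; `F(e) = (V′(|e|)/|e|)e`). [folklore] -/
theorem inner_force_sub_force (e d w' : E3) (hd : ‖d‖ < ‖e‖) :
    ⟪(deriv lennardJones ‖e + d‖ / ‖e + d‖) • (e + d) - (deriv lennardJones ‖e‖ / ‖e‖) • e, w'⟫ =
      secK e d d w' := by
  rw [ljForce_eq, ljForce_eq, secK]
  have hderiv : ∀ θ ∈ Set.uIcc (0 : ℝ) 1, HasDerivAt (fun θ : ℝ => ⟪ljH (‖e + θ • d‖ ^ 2) • (e + θ • d), w'⟫)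
      (kForm (e + θ • d) d w') θ := by
    intro θ hθ
    rw [Set.uIcc_of_le zero_le_one] at hθ
    exact hasDerivAt_inner_force_segment e d w' (add_smul_ne_zero hd hθ.1 hθ.2)
  rw [intervalIntegral.integral_eq_sub_of_hasDerivAt hderiv (intervalIntegrable_kForm_segment hd d w')]
  simp [inner_sub_left]

/-! ## Algebra and bounds for `secK` -/

/-- **On the diagonal `secK` is the vocabulary's `secHess`** (`‖d‖ < ‖e‖`). [folklore] -/
theorem secK_self {e d : E3} (hd : ‖d‖ < ‖e‖) (w : E3) : secK e d w w = secHess e d w := by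
  rw [secK, secHess]
  refine intervalIntegral.integral_congr fun θ hθ => ?_
  rw [Set.uIcc_of_le zero_le_one] at hθ
  exact kForm_self (add_smul_ne_zero hd hθ.1 hθ.2) w

/-- `secK` is symmetric. [folklore] -/
theorem secK_comm (e d w w' : E3) : secK e d w w' = secK e d w' w := by
  simp only [secK, kForm_comm _ w w']

/-- `secK` is even: reversing the bond and the displacement difference changes nothing. [folklore] -/
theorem secK_neg_neg (e d w w' : E3) : secK (-e) (-d) w w' = secK e d w w' := by
  simp only [secK]
  refine intervalIntegral.integral_congr fun θ _ => ?_
  simp only [smul_neg, ← neg_add, kForm_neg]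

/-- `secK e d 0 w' = 0`. [folklore] -/
@[simp] theorem secK_zero_left (e d w' : E3) : secK e d 0 w' = 0 := by
  simp [secK]

/-- `secK e d w 0 = 0`. [folklore] -/
@[simp] theorem secK_zero_right (e d w : E3) : secK e d w 0 = 0 := by
  rw [secK_comm, secK_zero_left]

/-- `secK` vanishes at the zero bond with zero displacement difference (the diagonal `p = q`). [folklore] -/
@[simp] theorem secK_zero_bond (w w' : E3) : secK 0 0 w w' = 0 := by
  simp [secK]

/-- `secK` is homogeneous in `w`. [folklore] -/
theorem secK_smul_left (e d w w' : E3) (c : ℝ) : secK e d (c • w) w' = c * secK e d w w' := by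
  simp only [secK, kForm_smul_left]
  exact intervalIntegral.integral_const_mul c _

/-- `secK` is homogeneous in `w'`. [folklore] -/
theorem secK_smul_right (e d w w' : E3) (c : ℝ) : secK e d w (c • w') = c * secK e d w w' := by
  rw [secK_comm, secK_smul_left, secK_comm]

/-- `secK` is additive in `w` (`‖d‖ < ‖e‖`, so that both integrands are integrable). [folklore] -/
theorem secK_add_left {e d : E3} (hd : ‖d‖ < ‖e‖) (w₁ w₂ w' : E3) :
    secK e d (w₁ + w₂) w' = secK e d w₁ w' + secK e d w₂ w' := by
  simp only [secK, kForm_add_left]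
  exact intervalIntegral.integral_add (intervalIntegrable_kForm_segment hd w₁ w')
    (intervalIntegrable_kForm_segment hd w₂ w')

/-- `secK` is additive in `w'`. [folklore] -/
theorem secK_add_right {e d : E3} (hd : ‖d‖ < ‖e‖) (w w₁ w₂ : E3) :
    secK e d w (w₁ + w₂) = secK e d w w₁ + secK e d w w₂ := by
  rw [secK_comm, secK_add_left hd, secK_comm e d w₁, secK_comm e d w₂]

/-- `secK` is subtractive in `w`. [folklore] -/
theorem secK_sub_left {e d : E3} (hd : ‖d‖ < ‖e‖) (w₁ w₂ w' : E3) :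
    secK e d (w₁ - w₂) w' = secK e d w₁ w' - secK e d w₂ w' := by
  rw [sub_eq_add_neg, secK_add_left hd, ← neg_one_smul ℝ w₂, secK_smul_left]
  ring

/-- `secK` is subtractive in `w'`. [folklore] -/
theorem secK_sub_right {e d : E3} (hd : ‖d‖ < ‖e‖) (w w₁ w₂ : E3) :
    secK e d w (w₁ - w₂) = secK e d w w₁ - secK e d w w₂ := by
  rw [secK_comm, secK_sub_left hd, secK_comm e d w₁, secK_comm e d w₂]

/-- **Kernel bound**: for a bond `|e| ≥ 23/25` and a displacement difference `|d| ≤ 3/20`,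
`|secK e d w w'| ≤ 248064·|e|⁻⁸‖w‖‖w'‖` (`‖e + θd‖ ≥ max(1/2, ‖e‖/2)`, `969·2⁸ = 248064`). [folklore] -/
theorem abs_secK_le {e d : E3} (he : (23 / 25 : ℝ) ≤ ‖e‖) (hd : ‖d‖ ≤ 3 / 20) (w w' : E3) :
    |secK e d w w'| ≤ 248064 * (‖e‖⁻¹) ^ 8 * ‖w‖ * ‖w'‖ := by
  have hpos : 0 < ‖e‖ := by linarith
  have hbound : ∀ θ ∈ Set.uIoc (0 : ℝ) 1, ‖kForm (e + θ • d) w w'‖ ≤ 248064 * (‖e‖⁻¹) ^ 8 * ‖w‖ * ‖w'‖ := by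
    intro θ hθ
    rw [Set.uIoc_of_le zero_le_one] at hθ
    have hy := norm_sub_le_norm_add_smul e d hθ.1.le hθ.2
    have hy1 : (1 / 2 : ℝ) ≤ ‖e + θ • d‖ := by linarith
    have hy2 : ‖e‖ / 2 ≤ ‖e + θ • d‖ := by linarith
    have hypos : 0 < ‖e + θ • d‖ := by linarith
    have hinv : ‖e + θ • d‖⁻¹ ≤ 2 * ‖e‖⁻¹ := by
      rw [show 2 * ‖e‖⁻¹ = (‖e‖ / 2)⁻¹ by rw [inv_div]; ring]
      exact inv_anti₀ (by positivity) hy2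
    have h8 : (‖e + θ • d‖⁻¹) ^ 8 ≤ 256 * (‖e‖⁻¹) ^ 8 := by
      calc (‖e + θ • d‖⁻¹) ^ 8 ≤ (2 * ‖e‖⁻¹) ^ 8 := pow_le_pow_left₀ (inv_nonneg.2 hypos.le) hinv 8
        _ = 256 * (‖e‖⁻¹) ^ 8 := by ring
    rw [Real.norm_eq_abs]
    calc |kForm (e + θ • d) w w'| ≤ 969 * (‖e + θ • d‖⁻¹) ^ 8 * ‖w‖ * ‖w'‖ := abs_kForm_le hy1 w w'
      _ ≤ 969 * (256 * (‖e‖⁻¹) ^ 8) * ‖w‖ * ‖w'‖ := by gcongr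
      _ = 248064 * (‖e‖⁻¹) ^ 8 * ‖w‖ * ‖w'‖ := by ring
  have h := intervalIntegral.norm_integral_le_of_norm_le_const hbound
  rw [Real.norm_eq_abs, sub_zero, abs_one, mul_one] at h
  exact h

/-- **The cut-off identity** (discrete product rule behind Caccioppoli): for a cut-off taking the values
`a`, `b` at the two ends of a bond and a field taking the values `G`, `H`,
`B(aG − bH, aG − bH) = B(G − H, a²G − b²H) + (a − b)²·B(G, H)` for the symmetric bilinear `B = secK e d`.
Summed over bonds, the first term on the right is the bilinear form tested against `χ²g`, which vanishes
on a solution. [folklore] -/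
theorem secK_cutoff_identity {e d : E3} (hd : ‖d‖ < ‖e‖) (a b : ℝ) (G H : E3) :
    secK e d (a • G - b • H) (a • G - b • H) =
      secK e d (G - H) (a ^ 2 • G - b ^ 2 • H) + (a - b) ^ 2 * secK e d G H := by
  simp only [secK_sub_left hd, secK_sub_right hd, secK_smul_left, secK_smul_right, secK_comm e d H G]
  ring

end LevelOne

/-- Registered sub-goal carrying this helper file (crux stmt-AtomisticToContinuum-9332, line `Sketch`, level 1):
on the diagonal the secant bilinear form is the vocabulary's `secHess`. [folklore] -/
theorem levelOne_secant : ∀ e d w : E3, ‖d‖ < ‖e‖ → LevelOne.secK e d w w = secHess e d w := by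
  intro e d w hd
  exact LevelOne.secK_self hd w

end Summit.AtomisticToContinuum.Crystallization.Theorems.ExcessDecayLiouville

end
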